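import Literature.MathematicalPhysics.QuantumFieldTheory.Balaban1983to89.B9Thm312WholeLeft
import Literature.MathematicalPhysics.QuantumFieldTheory.Balaban1983to89.B9RWSums343Holder
import Literature.MathematicalPhysics.QuantumFieldTheory.Balaban1983to89.B9Ineq347AllEntries

/-!
# `Balaban1983to89.B9Thm312WholeClasses` — [B9] Theorem 3.12 (p. 423): the Sect.-D perturbation series in the HÖLDER NORM
# CLASSES — Theorem 3.3 for G₀ and the perturbation step in each class (schemas of printed shape), and the operator-level
# majorants (3.43)–(3.45) of G, G₁ they yield at one member and one configuration

T. Bałaban, *Propagators for lattice gauge theories in a background field*, Commun. Math. Phys. **99** (1985) 389–434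
[`Balaban1985BackgroundPropagators`, "B9"]; [4] = T. Bałaban, *Propagators and renormalization transformations for lattice
gauge theories. II*, Commun. Math. Phys. **96** (1984) 223–250 [`Balaban1984PropagatorsII`].

statement-level skeleton of published theorems with citation tags; proofs where landed; nothing here is a claim about the
Yang–Mills mass gap

THE PRINTED LOCI (verbatim, held text `paper:balaban1985-cmp99-background-propagators`).  (3.43)–(3.45) p. 398:
*"‖ζ∇_UG′(U)λ‖_β, ‖ζG′(U)∇\*_Uλ‖_β ≦ B₀(β₀)(Lʲη)^{1−β}(‖ζ‖^ξ_β + |ζ|)e^{−δ₀d(y,y′)}|λ| … |(∇_UG′(U)∇\*_Uλ)(x)| ≦ B′₀(ε)e^{−δ₀d(y,y′)}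
(‖λ‖^{ξ′}_ε + |λ|) … ‖ζ∇_UG′(U)∇\*_Uλ‖_β ≦ B′₀(ε,β₀)(Lʲη)^{−β}(‖ζ‖^ξ_β + |ζ|)e^{−δ₀d(y,y′)}(‖λ‖^{ξ′}_{β+ε} + |λ|)"*; Theorem 3.3
p. 399: *"the operator G(U) (a = 1) satisfies the inequalities (3.42)–(3.47)"* (= G₀ of Sect. D, p. 421); (3.130) p. 421: *"G =
G₀(I − Δ′_πG₀)⁻¹ = Σ_{n=0}^∞ G₀(Δ′_πG₀)ⁿ"*; p. 421: *"One of the three derivatives there has to be applied either to an expression on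
the right, or on the left, of Δ′_π"*; p. 422: *"This inequality [(3.131)] and Theorem 3.3 for G₀ imply a convergence of the series
(3.130), for α₀ sufficiently small, in all norms appearing on the left-hand sides of the inequalities (3.42)–(3.47), except the
inequality involving the Laplace operator in (3.42). Thus we have Theorem 3.3. for G, with this exception."*; p. 423 (G₁, (3.138)):
*"It is connected with the fact that we have derivatives in the operator Δ′_π + Δ⁽²⁾_π which have to be applied either to the
operator on the right, or on the left … ‖…‖ ≦ … δ₀d(y₁,y₂)|Δ(y₂)Δ⁽²⁾_πΔ(y′)λ| the supremum |λ| is taken over several j-blocks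
surrounding Δ(y_j). This estimate is given for first factors in a term, the remaining factors are easier to estimate, following
the above pattern. Let us notice that constants O(1) we get depend only on B₀(ε) with ε properly chosen (e.g. ε = 1/2) … The
convergence is in all norms appearing in the formulation of Theorem 3.3. This implies that the theorem is valid for G₁."*; p. 398:
*"the choice of powers Lʲη is conventional also. Using Lemma 2.1 in [4] we may replace the factor (Lʲη)^α by (Lʲη)^β(L^{j′}η)^γ
with β + γ = α"*.

THE POINT.  Seat n06-l's leaves of rows 20–21 (`…B9Thm312WholeLeafRelH.thm312Printed_of_stepRelH`,
`…B9Thm313WholeLeafRel.thm313Printed_of_stepRel`) PROVE the sup classes of Theorem 3.12 ∕ 3.13 ((3.42)₁₂₃, (3.47)₀₁₂, the sup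
members of (3.133)) from SCHEMAS OF PRINTED SHAPE — Theorem 3.3 for G₀ in the sup classes (`Thm33G0`, `LeftStep.e1`) and THE
PERTURBATION STEP in the sup classes (`Step`, `LeftStep.stepD`) — and DISPLAY the Hölder block (3.43)–(3.45) and the L² block (3.46)
as residual hypotheses about G, G₁, 𝔊 themselves.  THIS FILE carries print's one-sentence argument (p. 422) into the HÖLDER CLASSES
with the same division of labour, in the currency of n06-k's reading layer (`B9RWSums343Holder.HolderProbes`: the Hölder
quotients of (3.40) as linear PROBES Φ^X_β(U), Φ^Y_β(U) into probe lattices; the input Hölder norms as block-norm LETTERS `bH ε`):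
* §1 `cNormR R₀ H₀ blk hlen s` — the state norm 𝔠^{(s)} with a REAL scale weight (Lʲη)ˢ (β-dependent weights need real exponents;
  `B9Thm312Whole.cNorm … p` is 𝔠^{(−p)}), the conversions with the two-space sup majorants of [4] (2.51) and with `cNorm`, and
  ★ `hasMaj_transfer` — the printed convention of p. 398 made a lemma: a majorant C·e^{−ρd} from 𝔠^{(t)} to 𝔠^{(s)} is
  C·Λ·e^{−(1−α)ρd} from 𝔠^{(t+γ)} to 𝔠^{(s+γ)} under the scale transfer (2.60) (`B9Ineq347.ScaleTransfer … Λ (Lʲη)^γ`,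
  `scaleTransfer_rpow_of_260`).
* §2 HYPOTHESIS SCHEMAS of printed shape (Prop structures; nothing asserted): `Thm33G0H` = THEOREM 3.3 (3.43)–(3.45) FOR G₀ at U,
  read through the probes and the input norms (exactly the shapes n06-k's engines `line343_of_hasMajorantHom_rel` ∕
  `lines3445_of_hasMaj_rel` consume, for G₀ instead of G); `StepH` = THE PERTURBATION STEP IN THE HÖLDER CLASSES: the Hölder probe
  of ∇_UG₀T from 𝔠^{(−2)} (p. 423's displayed pattern), the Hölder probe of G₀T from 𝔠^{(−1)}, and TG₀∇\*_U from the input class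
  `bH ε` into 𝔠^{(1)} — for T = Δ′_π and T = Δ′_π + Δ⁽²⁾_π, θ = O(1)·Mα₀ in print, the species of `Step.step` ∕ `LeftStep.stepD`
  (their derivations from (3.131), (3.137), Theorems 3.1–3.3 and (3.49) are the located gap G-B9-16 — declared, not typed).
* THE THEOREMS are the sequel `…B9Thm312WholeHolder` (kept apart so that this DEFINITION file stays short): one member, one U,
  A ∈ {G, G₁} — the probe majorants of Φ^Y_β∘∇_U∘A and Φ^X_β∘(A∘∇\*_U) ((3.43)) and the input-class majorants of ∇_UA∇\*_U and
  Φ^Y_β∘∇_UA∇\*_U ((3.44), (3.45)), i.e. the inputs `hL`, `hRt`, `h44`, `h45` of n06-k's engines FOR G AND G₁; the family leaves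
  consuming them are `…B9Thm312WholeLeafAll`, `…B9Thm313WholeLeafAll`.

HONEST SCOPE.  Nothing of [B9] or [4] is asserted: Theorem 3.3 for G₀ in the Hölder classes, the three step majorants per class
and [4] (2.60) are HYPOTHESES of printed ∕ definitional shape; the content is print's bookkeeping (one resolvent identity, one
composition [4] (2.54)+(2.61), one scale transfer (2.60) per member), kernel-checked.  NOT a node discharge, NOT summit progress;
one finite lattice at a time; nothing continuum, nothing about the mass gap.  Cell `pub-ymgap` (HUMAN RULING D-0062), Track A node
N06 [B9], N06-ASSIGNMENT v1 rows 20–21 (bundle F7), seat `pub-ymgap-dag-n06-l` (g4), 2026-08-27.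
-/

namespace Literature.MathematicalPhysics.QuantumFieldTheory.Balaban1983to89.B9Thm312WholeClasses

open Literature.MathematicalPhysics.QuantumFieldTheory.Balaban1983to89
open Finset B6RandomWalk B6RandomWalkHom B9Thm34Ext B9Thm37GlueCor36 B11SectG B9SectDSup
open B9Thm37AllNorms B9Thm37AllNormsInstances B9Thm312Whole B9Thm312WholeLeaf B9Thm312WholeLeft B9RWSums343Holder
open B9Ineq347 B9Ineq347AllEntries

noncomputable section

/-! ## §1 The state norm 𝔠^{(s)} with a real scale weight, its conversions, and the scale transfer of p. 398 -/

section Norms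

variable {g : B9.Geometry} {B : B9.Backgrounds} {X V : Type} [Fintype X] [Fintype V] [Fintype g.Site]
variable {R₀ : ℝ} {H₀ : Prop}

/-- The real scale weight (Lʲη)ˢ attached to a coarse site (s ∈ ℝ). [cite: Balaban1985BackgroundPropagators, (3.41) p.397] -/
def rwt (g : B9.Geometry) (s : ℝ) (y : g.Site) : ℝ := g.len y ^ s

omit [Fintype g.Site] in
/-- The real scale weights are non-negative when the scale lengths are. [cite: Balaban1985BackgroundPropagators, (3.41) p.397 (bookkeeping)] -/
theorem rwt_nonneg (hlen : ∀ y : g.Site, 0 ≤ g.len y) (s : ℝ) (y : g.Site) : 0 ≤ rwt g s y :=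
  Real.rpow_nonneg (hlen y) s

omit [Fintype g.Site] in
/-- The real scale weights are positive under `GeoOK`. [cite: Balaban1985BackgroundPropagators, (3.41) p.397 (bookkeeping)] -/
theorem rwt_pos (hG : GeoOK g) (s : ℝ) (y : g.Site) : 0 < rwt g s y :=
  Real.rpow_pos_of_pos (hG.lenpos y) s

/-- **THE STATE NORM 𝔠^{(s)}, REAL WEIGHT**: the sharp-block sup size of the lattice `X` rescaled by (Lʲη)ˢ — size of f near y =
(Lʲη)ˢ·sup_{x∈Δ(y)}|f(x)| (`B9SectDSup.weightNorm` of `B11SectG.BlockNorm.ofBlocks`; `B9Thm312Whole.cNorm … p` is the case s = −p).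
The Hölder classes of (3.43), (3.45) carry the weights (Lʲη)^{β−1}, (Lʲη)^{β}. [cite: Balaban1985BackgroundPropagators, (3.42)–(3.45) pp.397–398; Balaban1984PropagatorsII, (2.51) p.232] -/
def cNormR (R₀ : ℝ) (H₀ : Prop) (blk : X → g.Site) (hlen : ∀ y : g.Site, 0 ≤ g.len y) (s : ℝ) :
    BlockNorm (toB6 g R₀ H₀) (X → ℝ) :=
  weightNorm (BlockNorm.ofBlocks (toB6 g R₀ H₀) blk) (rwt g s) (rwt_nonneg hlen s)

/-- The cutting cost of 𝔠^{(s)} is 1 (sharp blocks). [cite: Balaban1984PropagatorsII, (2.51)–(2.52) p.232 (bookkeeping)] -/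
@[simp] theorem cNormR_κ (blk : X → g.Site) (hlen : ∀ y : g.Site, 0 ≤ g.len y) (s : ℝ) :
    (cNormR R₀ H₀ blk hlen s).κ = 1 := rfl

/-- The local size of 𝔠^{(s)}: (Lʲη)ˢ × the sharp-block sup size. [cite: Balaban1985BackgroundPropagators, (3.42) p.397 (bookkeeping)] -/
theorem cNormR_loc (blk : X → g.Site) (hlen : ∀ y : g.Site, 0 ≤ g.len y) (s : ℝ) (y : g.Site) (f : X → ℝ) :
    (cNormR R₀ H₀ blk hlen s).loc y f = g.len y ^ s * (BlockNorm.ofBlocks (toB6 g R₀ H₀) blk).loc y f := rfl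

/-- Localisation in 𝔠^{(s)} is *"supp μ ⊂ Δ(y′)"*. [cite: Balaban1984PropagatorsII, (2.51) p.232 (bookkeeping)] -/
theorem cNormR_isLoc (blk : X → g.Site) (hlen : ∀ y : g.Site, 0 ≤ g.len y) (s : ℝ) (y : g.Site) (μ : X → ℝ) :
    (cNormR R₀ H₀ blk hlen s).IsLoc y μ ↔ ∀ x, blk x ≠ y → μ x = 0 := Iff.rfl

/-- 𝔠^{(−p)} has the local sizes of `B9Thm312Whole.cNorm … p` (integer and real weights agree on positive lengths).
[cite: Balaban1985BackgroundPropagators, (3.42) p.397 (bookkeeping)] -/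
theorem cNormR_loc_neg_natCast (hG : GeoOK g) (blk : X → g.Site) (p : ℕ) (y : g.Site) (f : X → ℝ) :
    (cNormR R₀ H₀ blk hG.lenle (-(p : ℝ))).loc y f = (cNorm R₀ H₀ blk hG.lenle p).loc y f := by
  simp only [cNormR, cNorm, weightNorm_loc, rwt, wt, Real.rpow_neg (hG.lenle y), Real.rpow_natCast]

/-- A majorant between the integer-weight state norms `cNorm … q → cNorm … p` is the same majorant between 𝔠^{(−q)} and 𝔠^{(−p)}.
[cite: Balaban1985BackgroundPropagators, (3.42) p.397 (bookkeeping)] -/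
theorem hasMaj_toR (hG : GeoOK g) {blkV : V → g.Site} {blk : X → g.Site} {T : (V → ℝ) →ₗ[ℝ] (X → ℝ)}
    {K : g.Site → g.Site → ℝ} {p q : ℕ}
    (h : HasMaj (cNorm R₀ H₀ blkV hG.lenle q) (cNorm R₀ H₀ blk hG.lenle p) T K) :
    HasMaj (cNormR R₀ H₀ blkV hG.lenle (-(q : ℝ))) (cNormR R₀ H₀ blk hG.lenle (-(p : ℝ))) T K := by
  intro y' μ hμ y
  rw [cNormR_loc_neg_natCast hG, cNormR_loc_neg_natCast hG]
  exact h y' μ hμ y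

/-- **A TWO-SPACE SUP MAJORANT WITH TWO-SIDED SCALE POWERS IS A MAJORANT BETWEEN THE STATE NORMS**: |(Tμ)(x)| ≦
C(y,y′)(Lʲη)ˢ(L^{j′}η)ᵗ|μ| for x ∈ Δ(y), supp μ ⊂ Δ(y′) ⇒ T has majorant C from 𝔠^{(t)} into 𝔠^{(−s)} (the weights moved into the
sizes — `B9SectDSup.HasMaj.weight`, exact). [cite: Balaban1985BackgroundPropagators, p.398 (remark after (3.47)); Balaban1984PropagatorsII, (2.51) p.232] -/
theorem hasMaj_cNormR_of_hasMajorantHom (hG : GeoOK g) {blkV : V → g.Site} {blk : X → g.Site}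
    {T : (V → ℝ) →ₗ[ℝ] (X → ℝ)} {C : g.Site → g.Site → ℝ} (hC : ∀ a b, 0 ≤ C a b) (s t : ℝ)
    (h : HasMajorantHom (g := toB6 g R₀ H₀) blkV blk T (fun (a b : g.Site) => C a b * g.len a ^ s * g.len b ^ t)) :
    HasMaj (cNormR R₀ H₀ blkV hG.lenle t) (cNormR R₀ H₀ blk hG.lenle (-s)) T C := by
  have hK : ∀ a b : g.Site, 0 ≤ C a b * g.len a ^ s * g.len b ^ t := fun a b =>
    mul_nonneg (mul_nonneg (hC a b) (Real.rpow_nonneg (hG.lenle a) _)) (Real.rpow_nonneg (hG.lenle b) _)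
  have h0 := hasMaj_of_hasMajorantHom (G := toB6 g R₀ H₀) blkV blk hK h
  refine HasMaj.weight (rwt_nonneg hG.lenle t) (rwt_nonneg hG.lenle (-s)) h0 fun y y' => le_of_eq ?_
  simp only [rwt]
  rw [Real.rpow_neg (hG.lenle y)]
  have hy : g.len y ^ s ≠ 0 := (Real.rpow_pos_of_pos (hG.lenpos y) s).ne'
  calc (g.len y ^ s)⁻¹ * (C y y' * g.len y ^ s * g.len y' ^ t)
      = C y y' * g.len y' ^ t * ((g.len y ^ s)⁻¹ * g.len y ^ s) := by ring
    _ = C y y' * g.len y' ^ t := by rw [inv_mul_cancel₀ hy, mul_one]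

/-- **READING A STATE-NORM MAJORANT BACK AS A TWO-SPACE SUP MAJORANT**: a majorant K ≧ 0 from 𝔠^{(t)} into 𝔠^{(s)} is the [4]-(2.51)
majorant K(y,y′)(Lʲη)^{−s}(L^{j′}η)ᵗ. [cite: Balaban1984PropagatorsII, (2.51) p.232; Balaban1985BackgroundPropagators, (3.42) p.397] -/
theorem hasMajorantHom_of_hasMaj_cNormR (hG : GeoOK g) {blkV : V → g.Site} {blk : X → g.Site}
    {T : (V → ℝ) →ₗ[ℝ] (X → ℝ)} {K : g.Site → g.Site → ℝ} (hK : ∀ a b, 0 ≤ K a b) {s t : ℝ}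
    (h : HasMaj (cNormR R₀ H₀ blkV hG.lenle t) (cNormR R₀ H₀ blk hG.lenle s) T K) :
    HasMajorantHom (g := toB6 g R₀ H₀) blkV blk T (fun (a b : g.Site) => K a b * g.len a ^ (-s) * g.len b ^ t) := by
  intro y' μ B' hμ x
  have hloc : (cNormR R₀ H₀ blkV hG.lenle t).IsLoc y' μ := fun v hv => hμ.off v hv
  have hb := h y' μ hloc (blk x)
  rw [cNormR_loc, cNormR_loc] at hb
  have hws : 0 < g.len (blk x) ^ s := Real.rpow_pos_of_pos (hG.lenpos (blk x)) s
  have h1 : |T μ x| ≤ (BlockNorm.ofBlocks (toB6 g R₀ H₀) blk).loc (blk x) (T μ) :=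
    abs_apply_le_ofBlocks_loc (G := toB6 g R₀ H₀) blk (blk x) (T μ) x rfl
  have h2 : (BlockNorm.ofBlocks (toB6 g R₀ H₀) blkV).loc y' μ ≤ B' :=
    ofBlocks_loc_le_of_blockSupp (G := toB6 g R₀ H₀) blkV hμ
  have h3 : (BlockNorm.ofBlocks (toB6 g R₀ H₀) blk).loc (blk x) (T μ) ≤
      (g.len (blk x) ^ s)⁻¹ * (K (blk x) y' * (g.len y' ^ t * B')) := by
    rw [le_inv_mul_iff₀ hws]
    exact hb.trans (mul_le_mul_of_nonneg_left (mul_le_mul_of_nonneg_left h2 (Real.rpow_nonneg (hG.lenle y') t))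
      (hK _ _))
  calc |T μ x| ≤ (g.len (blk x) ^ s)⁻¹ * (K (blk x) y' * (g.len y' ^ t * B')) := h1.trans h3
    _ = K (blk x) y' * g.len (blk x) ^ (-s) * g.len y' ^ t * B' := by rw [Real.rpow_neg (hG.lenle (blk x))]; ring

/-- Removing the output weight: a majorant K from any block-normed space into 𝔠^{(s)} is the majorant K(y,y′)(Lʲη)^{−s} into the
plain sharp-block sizes. [cite: Balaban1985BackgroundPropagators, p.398 (remark after (3.47)), bookkeeping] -/
theorem hasMaj_unweight_out (hG : GeoOK g) {F : Type} [AddCommGroup F] [Module ℝ F] {b₀ : BlockNorm (toB6 g R₀ H₀) F}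
    {blk : X → g.Site} {T : F →ₗ[ℝ] (X → ℝ)} {K : g.Site → g.Site → ℝ} {s : ℝ}
    (h : HasMaj b₀ (cNormR R₀ H₀ blk hG.lenle s) T K) :
    HasMaj b₀ (BlockNorm.ofBlocks (toB6 g R₀ H₀) blk) T (fun (a b : g.Site) => K a b * g.len a ^ (-s)) := by
  intro y' μ hμ y
  have hb := h y' μ hμ y
  rw [cNormR_loc] at hb
  have hws : 0 < g.len y ^ s := Real.rpow_pos_of_pos (hG.lenpos y) s
  show (BlockNorm.ofBlocks (toB6 g R₀ H₀) blk).loc y (T μ) ≤ K y y' * g.len y ^ (-s) * b₀.loc y' μ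
  rw [Real.rpow_neg (hG.lenle y)]
  calc (BlockNorm.ofBlocks (toB6 g R₀ H₀) blk).loc y (T μ) ≤ (g.len y ^ s)⁻¹ * (K y y' * b₀.loc y' μ) :=
        (le_inv_mul_iff₀ hws).mpr hb
    _ = K y y' * (g.len y ^ s)⁻¹ * b₀.loc y' μ := by ring

/-- Inserting an output weight: a majorant K(y,y′)(Lʲη)^{−s} into the plain sharp-block sizes is the majorant K into 𝔠^{(s)}.
[cite: Balaban1985BackgroundPropagators, p.398 (remark after (3.47)), bookkeeping] -/
theorem hasMaj_weight_out (hG : GeoOK g) {F : Type} [AddCommGroup F] [Module ℝ F] {b₀ : BlockNorm (toB6 g R₀ H₀) F}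
    {blk : X → g.Site} {T : F →ₗ[ℝ] (X → ℝ)} {K : g.Site → g.Site → ℝ} {s : ℝ}
    (h : HasMaj b₀ (BlockNorm.ofBlocks (toB6 g R₀ H₀) blk) T (fun (a b : g.Site) => K a b * g.len a ^ (-s))) :
    HasMaj b₀ (cNormR R₀ H₀ blk hG.lenle s) T K := by
  intro y' μ hμ y
  have hb : (BlockNorm.ofBlocks (toB6 g R₀ H₀) blk).loc y (T μ) ≤ K y y' * g.len y ^ (-s) * b₀.loc y' μ := h y' μ hμ y
  rw [cNormR_loc]
  have hws : 0 < g.len y ^ s := Real.rpow_pos_of_pos (hG.lenpos y) s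
  rw [Real.rpow_neg (hG.lenle y)] at hb
  have hy : g.len y ^ s * (g.len y ^ s)⁻¹ = 1 := mul_inv_cancel₀ hws.ne'
  calc g.len y ^ s * (BlockNorm.ofBlocks (toB6 g R₀ H₀) blk).loc y (T μ)
      ≤ g.len y ^ s * (K y y' * (g.len y ^ s)⁻¹ * b₀.loc y' μ) := mul_le_mul_of_nonneg_left hb hws.le
    _ = K y y' * b₀.loc y' μ * (g.len y ^ s * (g.len y ^ s)⁻¹) := by ring
    _ = K y y' * b₀.loc y' μ := by rw [hy, mul_one]

/-- 𝔠^{(0)} into a target: the same as the plain sharp-block sizes (weight (Lʲη)⁰ = 1) — output side. [cite: Balaban1984PropagatorsII, (2.51) p.232 (bookkeeping)] -/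
theorem hasMaj_of_out_zero {F : Type} [AddCommGroup F] [Module ℝ F] {b₀ : BlockNorm (toB6 g R₀ H₀) F}
    {blk : X → g.Site} {hlen : ∀ y : g.Site, 0 ≤ g.len y} {T : F →ₗ[ℝ] (X → ℝ)} {K : g.Site → g.Site → ℝ}
    (h : HasMaj b₀ (cNormR R₀ H₀ blk hlen 0) T K) : HasMaj b₀ (BlockNorm.ofBlocks (toB6 g R₀ H₀) blk) T K := by
  intro y' μ hμ y
  have hb := h y' μ hμ y
  rw [cNormR_loc, Real.rpow_zero, one_mul] at hb
  exact hb

/-- 𝔠^{(0)} as a source: the same as the plain sharp-block sizes — input side. [cite: Balaban1984PropagatorsII, (2.51) p.232 (bookkeeping)] -/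
theorem hasMaj_of_in_zero {F : Type} [AddCommGroup F] [Module ℝ F] {b : BlockNorm (toB6 g R₀ H₀) F}
    {blkV : V → g.Site} {hlen : ∀ y : g.Site, 0 ≤ g.len y} {T : (V → ℝ) →ₗ[ℝ] F} {K : g.Site → g.Site → ℝ}
    (h : HasMaj (cNormR R₀ H₀ blkV hlen 0) b T K) : HasMaj (BlockNorm.ofBlocks (toB6 g R₀ H₀) blkV) b T K := by
  intro y' μ hμ y
  have hb := h y' μ hμ y
  rw [cNormR_loc, Real.rpow_zero, one_mul] at hb
  exact hb

/-- The plain sharp-block sizes as the source 𝔠^{(0)}. [cite: Balaban1984PropagatorsII, (2.51) p.232 (bookkeeping)] -/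
theorem hasMaj_to_in_zero {F : Type} [AddCommGroup F] [Module ℝ F] {b : BlockNorm (toB6 g R₀ H₀) F}
    {blkV : V → g.Site} {hlen : ∀ y : g.Site, 0 ≤ g.len y} {T : (V → ℝ) →ₗ[ℝ] F} {K : g.Site → g.Site → ℝ}
    (h : HasMaj (BlockNorm.ofBlocks (toB6 g R₀ H₀) blkV) b T K) : HasMaj (cNormR R₀ H₀ blkV hlen 0) b T K := by
  intro y' μ hμ y
  rw [cNormR_loc, Real.rpow_zero, one_mul]
  exact h y' μ hμ y

/-- **p. 398's SCALE TRANSFER FOR THE WEIGHT (Lʲη)^γ, |γ| ≦ 4**, from [4] (2.60) at the rate ρ and exponent α, the size condition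
4·log L ≦ αρRM, L ≧ 1 and η > 0: e^{−αρd(y,y′)}(L^{j′}η)^γ ≦ L^{|γ|}(Lʲη)^γ (n06-k's `B9RWSums346Schur.scaleTransfer_len_rpow` with the
member facts unbundled). [cite: Balaban1985BackgroundPropagators, p.398 (remark after (3.47)); Balaban1984PropagatorsII, Lemma 2.1 (2.60) p.234] -/
theorem scaleTransfer_rpow_of_260 {ρ α : ℝ} (h260 : Ineq260 (toB6 g R₀ H₀) ρ α) (hsize : 4 * Real.log g.L ≤ α * ρ * R₀ * g.M)
    (hL : 1 ≤ g.L) (hη : 0 < g.eta) (γ : ℝ) (hγ : |γ| ≤ 4) :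
    ScaleTransfer g ρ α (g.L ^ |γ|) (fun y => g.len y ^ γ) := by
  have hL0 : 0 < g.L := lt_of_lt_of_le one_pos hL
  obtain ⟨hsz, -⟩ := size_condition_compact g.L γ _ hL hγ hsize
  exact scaleTransfer_of_260 g ρ α (Real.exp (-(α * ρ * R₀ * g.M))) (g.L ^ |γ|) (fun y => g.len y ^ γ)
    (fun y y' => Nat.dist (g.scale y) (g.scale y')) (Real.exp_nonneg _) (Real.one_le_rpow hL (abs_nonneg γ))
    (rpow_abs_mul_exp_le_one g.L γ _ hL0 hsz) (weight_nonneg g hL0 hη γ)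
    (h260_nat_of_Ineq260 g R₀ H₀ ρ α h260) (fun y y' => weight_ratio g hL hη γ y y')

/-- ★ **THE SCALE TRANSFER OF p. 398 AS A CHANGE OF STATE CLASSES**: a majorant C·e^{−ρd} from 𝔠_V^{(t)} to 𝔠^{(s)} is the majorant
C·Λ·e^{−(1−α)ρd} from 𝔠_V^{(t+γ)} to 𝔠^{(s+γ)} whenever e^{−αρd(y,y′)}(L^{j′}η)^γ ≦ Λ(Lʲη)^γ (`B9Ineq347.ScaleTransfer`, from [4] (2.60)) and
d is symmetric — *"we may replace the factor (Lʲη)^α by (Lʲη)^β(L^{j′}η)^γ with β + γ = α"*. [cite: Balaban1985BackgroundPropagators, p.398 (remark after (3.47)); Balaban1984PropagatorsII, Lemma 2.1 (2.60) p.234] -/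
theorem hasMaj_transfer (hG : GeoOK g) {blkV : V → g.Site} {blk : X → g.Site} {T : (V → ℝ) →ₗ[ℝ] (X → ℝ)}
    {C ρ α Λ γ s t : ℝ} (hC : 0 ≤ C) (hST : ScaleTransfer g ρ α Λ (fun y => g.len y ^ γ))
    (h : HasMaj (cNormR R₀ H₀ blkV hG.lenle t) (cNormR R₀ H₀ blk hG.lenle s) T
      (fun a b => C * Real.exp (-(ρ * g.dist a b)))) :
    HasMaj (cNormR R₀ H₀ blkV hG.lenle (t + γ)) (cNormR R₀ H₀ blk hG.lenle (s + γ)) T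
      (fun a b => C * Λ * Real.exp (-((1 - α) * ρ * g.dist a b))) := by
  intro y' μ hμ y
  have hb := h y' μ hμ y
  rw [cNormR_loc, cNormR_loc] at hb
  rw [cNormR_loc, cNormR_loc, Real.rpow_add (hG.lenpos y), Real.rpow_add (hG.lenpos y')]
  set N := (BlockNorm.ofBlocks (toB6 g R₀ H₀) blk).loc y (T μ) with hN
  set N' := (BlockNorm.ofBlocks (toB6 g R₀ H₀) blkV).loc y' μ with hN'
  have hN'0 : 0 ≤ N' := (BlockNorm.ofBlocks (toB6 g R₀ H₀) blkV).loc_nonneg y' μ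
  have hγ0 : 0 ≤ g.len y ^ γ := Real.rpow_nonneg (hG.lenle y) γ
  have ht0 : 0 ≤ g.len y' ^ t := Real.rpow_nonneg (hG.lenle y') t
  -- the transfer at (y′, y): e^{−αρd(y′,y)} (Lʲη)^γ ≦ Λ (L^{j′}η)^γ
  have hst : Real.exp (-(α * ρ * g.dist y y')) * g.len y ^ γ ≤ Λ * g.len y' ^ γ := by
    have h1 := hST y' y
    rw [hG.symm y' y] at h1
    exact h1
  have hsplit : Real.exp (-(ρ * g.dist y y')) =
      Real.exp (-((1 - α) * ρ * g.dist y y')) * Real.exp (-(α * ρ * g.dist y y')) := by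
    rw [← Real.exp_add]; congr 1; ring
  have hE : 0 ≤ C * Real.exp (-((1 - α) * ρ * g.dist y y')) := mul_nonneg hC (Real.exp_nonneg _)
  calc g.len y ^ s * g.len y ^ γ * N = g.len y ^ γ * (g.len y ^ s * N) := by ring
    _ ≤ g.len y ^ γ * (C * Real.exp (-(ρ * g.dist y y')) * (g.len y' ^ t * N')) := mul_le_mul_of_nonneg_left hb hγ0
    _ = C * Real.exp (-((1 - α) * ρ * g.dist y y')) * (Real.exp (-(α * ρ * g.dist y y')) * g.len y ^ γ) *
          (g.len y' ^ t * N') := by rw [hsplit]; ring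
    _ ≤ C * Real.exp (-((1 - α) * ρ * g.dist y y')) * (Λ * g.len y' ^ γ) * (g.len y' ^ t * N') :=
        mul_le_mul_of_nonneg_right (mul_le_mul_of_nonneg_left hst hE) (mul_nonneg ht0 hN'0)
    _ = C * Λ * Real.exp (-((1 - α) * ρ * g.dist y y')) * (g.len y' ^ t * g.len y' ^ γ * N') := by ring

end Norms

/-! ## §2 The hypothesis schemas: Theorem 3.3 for G₀ and the perturbation step in the Hölder classes -/

section Schemas

variable {g : B9.Geometry} {B : B9.Backgrounds} {X Y Z W PX PY : Type}
variable [Fintype X] [Fintype Y] [Fintype PX] [Fintype PY] [Fintype g.Site]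

/-- **THEOREM 3.3, THE HÖLDER MEMBERS (3.43)–(3.45), FOR G₀ AT THE CONFIGURATION U** (p. 399: G₀ = G(U) *"satisfies the inequalities
(3.42)–(3.47)"*), read through n06-k's probe letters `𝔭` ((3.40): the Hölder quotients with cut-off ζ ∈ C₀^∞(Δ̃(y)) as linear probes
Φ^Y_β(U) on the ∇-lattice `Y`, Φ^X_β(U) on `X`) and the input Hölder norms `bH ε` (block-norm letters): `h43L β` — the left member
‖ζ∇_UG₀λ‖_β ≦ B_h(β)(Lʲη)^{1−β}e^{−δ₀d}|λ| as the two-space sup majorant of Φ^Y_β∘∇_U∘G₀; `h43R β` — the right member ‖ζG₀∇\*_Uλ‖_β, the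
majorant of Φ^X_β∘G₀∘∇\*_U; `h44 ε` — (3.44) |∇_UG₀∇\*_Uλ| ≦ B_i(ε)e^{−δ₀d}(‖λ‖_ε + |λ|) as the majorant of ∇_UG₀∇\*_U from `bH ε` into the
sharp blocks of `Y`; `h45 ε β` — (3.45) as the majorant of Φ^Y_β∘∇_UG₀∇\*_U from `bH (β + ε)` into the probe lattice with the weight
(Lʲη)^{−β}.  EXACTLY the shapes n06-k's engines `B9RWSumsReadsRel.line343_of_hasMajorantHom_rel` ∕ `lines3445_of_hasMaj_rel` consume —
here for G₀, there for G.  A HYPOTHESIS SCHEMA (Theorem 3.3 is the leaf `t33` of the knit, not asserted here).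
[cite: Balaban1985BackgroundPropagators, Thm 3.3 p.399 + (3.43)–(3.45) p.398 + (3.40) p.397] -/
structure Thm33G0H (𝔬 : Ops g B X Y Z W) (𝔭 : HolderProbes g B X Y PX PY) (R₀ : ℝ) (H₀ : Prop)
    (bH : ℝ → BlockNorm (toB6 g R₀ H₀) (Y → ℝ)) (Bh Bi : ℝ → ℝ) (Bi2 : ℝ → ℝ → ℝ) (δ₀ : ℝ) (U : B.Cfg) : Prop where
  h43L : ∀ β : ℝ, 0 ≤ β → β < 1 → HasMajorantHom (g := toB6 g R₀ H₀) 𝔬.blk 𝔭.blkPY (𝔭.ΦY U β ∘ₗ (𝔬.D U ∘ₗ 𝔬.G0 U))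
    (fun (a b : g.Site) => Bh β * g.len a ^ (1 - β) * Real.exp (-(δ₀ * g.dist a b)))
  h43R : ∀ β : ℝ, 0 ≤ β → β < 1 → HasMajorantHom (g := toB6 g R₀ H₀) 𝔬.blkY 𝔭.blkPX (𝔭.ΦX U β ∘ₗ (𝔬.G0 U ∘ₗ 𝔬.Dstar U))
    (fun (a b : g.Site) => Bh β * g.len a ^ (1 - β) * Real.exp (-(δ₀ * g.dist a b)))
  h44 : ∀ ε : ℝ, 0 < ε → ε ≤ 1 → HasMaj (bH ε) (BlockNorm.ofBlocks (toB6 g R₀ H₀) 𝔬.blkY)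
    (𝔬.D U ∘ₗ (𝔬.G0 U ∘ₗ 𝔬.Dstar U)) (fun (a b : g.Site) => Bi ε * Real.exp (-(δ₀ * g.dist a b)))
  h45 : ∀ ε β : ℝ, 0 < ε → ε ≤ 1 → 0 ≤ β → β < 1 →
    HasMaj (bH (β + ε)) (BlockNorm.ofBlocks (toB6 g R₀ H₀) 𝔭.blkPY) (𝔭.ΦY U β ∘ₗ (𝔬.D U ∘ₗ (𝔬.G0 U ∘ₗ 𝔬.Dstar U)))
      (fun (a b : g.Site) => Bi2 ε β * g.len a ^ (-β) * Real.exp (-(δ₀ * g.dist a b)))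

/-- **THE PERTURBATION STEPS OF (3.130) ∕ (3.138) IN THE HÖLDER CLASSES** — the Hölder-norm members of p. 422's *"This inequality
[(3.131)] and Theorem 3.3 for G₀ imply a convergence of the series (3.130), for α₀ sufficiently small, in all norms appearing on
the left-hand sides of the inequalities (3.42)–(3.47)"* and of p. 423's displayed pattern for the first factor of a term (*"‖…‖ ≦ …
|Δ(y₂)Δ⁽²⁾_πΔ(y′)λ| … constants O(1) we get depend only on B₀(ε) with ε properly chosen"*), as block majorants θ·e^{−δ_K d} between
state classes (θ = O(1)·Mα₀ in print: *"each operator Δ′_π provides the small factor α₀"*): `pY β` — the Hölder probe of the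
DERIVATIVE of the step, Φ^Y_β∘∇_U∘G₀∘Δ′_π, from 𝔠^{(−2)} (bond fields A, weight (Lʲη)⁻²) into the probe class of weight (Lʲη)^{β−1};
`pX β` — the Hölder probe of the step itself, Φ^X_β∘G₀∘Δ′_π, from 𝔠^{(−1)} into the probe class of weight (Lʲη)^{β−1}; `tD ε` — the step
applied to G₀∇\*_U from the input Hölder class, Δ′_πG₀∇\*_U : `bH ε` → 𝔠^{(1)} (p. 421: *"One of the three derivatives there has to be
applied either to an expression on the right, or on the left, of Δ′_π"*); `pY1`, `pX1`, `tD1` the same for Δ′_π + Δ⁽²⁾_π ((3.138)).  The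
species of `B9Thm312Whole.Step.step` (𝔠^{(−p)} → 𝔠^{(−p)}) and `B9Thm312WholeLeft.LeftStep.stepD` (𝔠^{(−2)} → 𝔠_Y^{(−1)}); their
derivation from (3.131), (3.137), Theorems 3.1–3.3 and (3.49) is the located gap G-B9-16 (the cell md `SectD-sup-proof.md` THEOREM S),
declared, not typed.  A HYPOTHESIS SCHEMA; nothing asserted.
[cite: Balaban1985BackgroundPropagators, (3.130)–(3.131) pp.421–422 + (3.137)–(3.138) p.423 + (3.43)–(3.45) p.398] -/
structure StepH (𝔬 : Ops g B X Y Z W) (𝔭 : HolderProbes g B X Y PX PY) (R₀ : ℝ) (H₀ : Prop)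
    (bH : ℝ → BlockNorm (toB6 g R₀ H₀) (Y → ℝ)) (hlen : ∀ y : g.Site, 0 ≤ g.len y) (θ δK : ℝ) (U : B.Cfg) : Prop where
  pY : ∀ β : ℝ, 0 ≤ β → β < 1 → HasMaj (cNormR R₀ H₀ 𝔬.blk hlen (-2)) (cNormR R₀ H₀ 𝔭.blkPY hlen (β - 1))
    ((𝔭.ΦY U β ∘ₗ 𝔬.D U ∘ₗ 𝔬.G0 U) ∘ₗ 𝔬.Tpi U) (fun a b => θ * Real.exp (-(δK * g.dist a b)))
  pY1 : ∀ β : ℝ, 0 ≤ β → β < 1 → HasMaj (cNormR R₀ H₀ 𝔬.blk hlen (-2)) (cNormR R₀ H₀ 𝔭.blkPY hlen (β - 1))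
    ((𝔭.ΦY U β ∘ₗ 𝔬.D U ∘ₗ 𝔬.G0 U) ∘ₗ (𝔬.Tpi U + 𝔬.T2 U)) (fun a b => θ * Real.exp (-(δK * g.dist a b)))
  pX : ∀ β : ℝ, 0 ≤ β → β < 1 → HasMaj (cNormR R₀ H₀ 𝔬.blk hlen (-1)) (cNormR R₀ H₀ 𝔭.blkPX hlen (β - 1))
    ((𝔭.ΦX U β ∘ₗ 𝔬.G0 U) ∘ₗ 𝔬.Tpi U) (fun a b => θ * Real.exp (-(δK * g.dist a b)))
  pX1 : ∀ β : ℝ, 0 ≤ β → β < 1 → HasMaj (cNormR R₀ H₀ 𝔬.blk hlen (-1)) (cNormR R₀ H₀ 𝔭.blkPX hlen (β - 1))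
    ((𝔭.ΦX U β ∘ₗ 𝔬.G0 U) ∘ₗ (𝔬.Tpi U + 𝔬.T2 U)) (fun a b => θ * Real.exp (-(δK * g.dist a b)))
  tD : ∀ ε : ℝ, 0 < ε → HasMaj (bH ε) (cNormR R₀ H₀ 𝔬.blk hlen 1) (𝔬.Tpi U ∘ₗ (𝔬.G0 U ∘ₗ 𝔬.Dstar U))
    (fun a b => θ * Real.exp (-(δK * g.dist a b)))
  tD1 : ∀ ε : ℝ, 0 < ε → HasMaj (bH ε) (cNormR R₀ H₀ 𝔬.blk hlen 1) ((𝔬.Tpi U + 𝔬.T2 U) ∘ₗ (𝔬.G0 U ∘ₗ 𝔬.Dstar U))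
    (fun a b => θ * Real.exp (-(δK * g.dist a b)))

end Schemas

end

end Literature.MathematicalPhysics.QuantumFieldTheory.Balaban1983to89.B9Thm312WholeClasses
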